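import Mathlib
import HarnessLib
import Summits.Langlands.Langlands.Theses.SkinnerWilesDefectOne
import Summits.Langlands.Langlands.Theorems.SkinnerWilesDefectOneReducibleOrdinaryProModularDefs
import Literature.NumberTheory.GaloisRepresentations.AbsGaloisOuterConj
import Literature.NumberTheory.GaloisRepresentations.SymplecticMultiplier
import Literature.NumberTheory.GaloisRepresentations.AdmissibleExtensionRegime
import Literature.NumberTheory.GaloisRepresentations.PadicComplexEmbedding
import Literature.NumberTheory.Automorphic.GLnAdelicStructureProofs

/-!
# Line `siegel-wall-skinner-wiles` — crux `ReducibleOrdinaryProModular` (stmt-Langlands-12919)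
# of route `SkinnerWilesDefectOne`: SKELETON (crux-strategist, wall-breaker generation 1)

TRANSFER + STRENGTHEN at crux level.  The three dead lines (steinberg-hyperplane,
generic-eisenstein-rigidity, fine-selmer-codimension-two) all died on inputs that do not exist over
an imaginary quadratic field `F` (`F⁺ = ℚ`): (D1) family/torsion ordinary local–global
compatibility at an Eisenstein maximal ideal of the Bianchi Hida/completed Hecke algebra, (D2)
positive-defect patching at a dimension-one prime of a `Λ_F`-torsion residually reducible family,
(D4) the Iwasawa-theoretic smallness of the `Λ`-adic reducible strata.  This line moves the
Skinner–Wiles engine to a DEFECT-ZERO host with a Shimura variety: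

* induce: after Boxer–Calegari–Gee–Pilloni's dihedral quadratic twist `δ` (BCGP §7.5.4 =
  arXiv:1812.09269 Lemmas 312–313, pp. 127–128), `R := Ind_F^ℚ (ρ ⊗ δ) : Γ_ℚ → GSp₄(ℚ̄_p)` is
  symplectic, odd, irreducible, Borel-ordinary and `p`-DISTINGUISHED at `p`, of Hodge–Tate shape
  `(k−1, k−1, 0, 0)` — a point of the WALL `(k, 2)` of the weight space of `GSp₄/ℚ`
  (`stub_dihedralSymplecticInduction`, regime: `p` unramified in `F`, `det ρ` symplectifiable by a
  finite twist);
* seed: Skinner–Wiles step (II) transported — ONE classical ordinary Siegel/`GL₄` point with the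
  residual pseudo-character of `R` (Eisenstein/Yoshida/Ramakrishnan `GL₂ × GL₂ → GL₄` of the
  level-raised Eisenstein-congruent newform with the weight-one dihedral form of `Ind δ`)
  (`stub_siegelSeed`);
* ENGINE (heart): Skinner–Wiles 1999 §§2–4 run VERBATIM in the Hida–Tilouine–Urban–Pilloni
  ORDINARY family of the Siegel threefold (3 variables, finite torsion-free over `Λ`, Zariski-dense
  classical REGULAR points: Galois pseudo-representations, local–global compatibility at `p`
  (Urban 2005) and at `ℓ ≠ p` come for free from classical Siegel eigenforms — this kills (D1);
  patching at a nice prime is SW §3 at Taylor–Wiles defect ZERO on `Λ`-free modules of ordinary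
  `p`-adic Siegel cusp forms — this kills (D2); the symplectic constraint removes one dimension from
  every `Λ`-adic reducible stratum (Shapiro), so torsion-ness of the split Iwasawa module alone
  suffices — this kills (D4)): `R` is SIEGEL-PRO-AUTOMORPHIC (`stub_siegelSkinnerWiles`);
* exit on the wall: a Siegel-pro-automorphic, de Rham, doubly-ordinary INDUCED wall point is
  classical (Pilloni, Duke 169 (2020) p. 1650: "It should be true that classical eigenforms in
  `M′ ⊗ (k,2)` are exactly those with de Rham associated Galois representation but unfortunately we
  do not know how to establish this directly"; BCGP §1.2; Buzzard–Taylor 1999 one dimension up)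
  (`stub_wallClassicality`) — the honest open exit, shared with summit card bianchi-inside-siegel K1;
* descent: `Π` cuspidal on `GL₄/ℚ` with Galois representation `Ind(ρ ⊗ δ)` is `η_{F/ℚ}`-self-twisted,
  hence automorphically induced (Arthur–Clozel Thm. 3.4.2 (b), tree fact
  `ArthurClozel1989_inducedLift_of_twist_eq`), giving a cuspidal `π` on `GL₂(𝔸_F)` matching `ρ`
  (`stub_deinduction`), and classical ⇒ `p`-adically automorphic (`stub_proModOfClassical`);
* `stub_complementRegime`: the crux on the complement of the regime (honest label; the strategist
  census recommends the item-level split by this regime).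

The composition `ReducibleOrdinaryProModular_of` concludes the crux BY NAME (`crux_iff`, Defs).
Disproof used: `hunr` is consumed (necessary, `withoutAEUnramified_iff`); the conclusion keeps the
free tame level (`not_isPadicallyAutomorphic_full`, `exists_isPadicallyAutomorphic_bad_eq`).
-/

namespace Summit.Langlands.Langlands.Cruxes.ReducibleOrdinaryProModular.SiegelWallSkinnerWiles

set_option linter.dupNamespace false
set_option autoImplicit false

open scoped NumberField MatrixGroups
open Filter NumberField IsDedekindDomain Field Polynomial Matrix
open Literature.NumberTheory.Automorphic Literature.NumberTheory.Automorphic.BigHeckeGLn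
open Literature.NumberTheory.GaloisRepresentations
open Summit.Langlands.Langlands.Theses.SkinnerWilesDefectOne
open Summit.Langlands.Langlands.Cruxes.ReducibleOrdinaryProModular.SteinbergHyperplane (OrdLoc ProMod crux_iff)

noncomputable section

/-! ## 1. Vocabulary -/

section Vocabulary

variable {F : Type} [Field F] [NumberField F] (p : ℕ) [Fact p.Prime]

/-- The crux's hypotheses on `(ρ, ρ₀)`, bundled (verbatim: irreducible, a.e. unramified, residually
upper-triangular integral model, and the local clause `OrdLoc` of the Defs file). [folklore] -/
def CruxHyp (O : ValuationSubring (PadicAlgCl p)) (ρ : FramedGaloisRep F (PadicAlgCl p) 2)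
    (ρ₀ : absoluteGaloisGroup F →* GL (Fin 2) O) : Prop :=
  ρ.toGaloisRep.IsIrreducible ∧ (∀ᶠ v in cofinite, ρ.IsUnramifiedAt v) ∧
    ρ.HasUpperTriangularIntegralModel ρ₀ ∧ OrdLoc p O ρ ρ₀

/-- `ρ` is CRYSTALLINE-ORIENTED-ORDINARY at `v ∣ p` (the crux's local clause at `v` with exponent
`m = 1`: in an oriented frame the inertial diagonal characters are EXACTLY `ε^{k-1}` and `1`).  Used
at the places above `p` that are NOT split in `F/ℚ`: then both characters extend to `Γ_{ℚ_p}` and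
`Ind_{F_v}^{ℚ_p}` of the local representation is Borel-ordinary and `p`-distinguished for free, the
two extensions differing by the quadratic character of `F_v/ℚ_p` (`p` odd). [folklore] -/
def CrystallineOrientedAt (ρ : FramedGaloisRep F (PadicAlgCl p) 2) (v : HeightOneSpectrum (𝓞 F)) :
    Prop :=
  ∃ k : ℕ, 2 ≤ k ∧ ∃ Q : Matrix.GeneralLinearGroup (Fin 2) (PadicAlgCl p),
    Valued.v (Q.val 0 0) ≤ Valued.v (Q.val 1 0) ∧
    ∀ σ, (Q⁻¹ * ρ.toLocal v σ * Q).val 1 0 = 0 ∧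
      (σ ∈ absInertia (v.adicCompletion F) →
        (Q⁻¹ * ρ.toLocal v σ * Q).val 1 1 = 1 ∧
        (Q⁻¹ * ρ.toLocal v σ * Q).val 0 0 =
          algebraMap (Padic p) (PadicAlgCl p)
            (((GaloisRep.cyclotomicCharacter (v.adicCompletion F) p σ).val : PadicInt p) :
              Padic p) ^ (k - 1))

/-- The LOCAL CONDITION AT `v ∣ p` on a twist datum `(δ, τ)` making `Ind_F^ℚ(ρ ⊗ δ)` Borel-ordinary
AND `p`-DISTINGUISHED at `p` (BCGP §7.5.4, arXiv Lemma 313: "automatically weight 2 ordinary and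
p-distinguished", made explicit).  If `v` is SPLIT (`τ̄ • v ≠ v`): on the decomposition group
`D_v ≅ Γ_{ℚ_p}` the induced representation is `(ρ ⊗ δ)|_{D_v} ⊕ (ρ ⊗ δ)^τ|_{D_v}`, and we ask the
four residual diagonal characters `χ̄_b δ̄, χ̄_b^τ δ̄^τ` (the two ordinary lines, SW orientation) and
`χ̄_a δ̄, χ̄_a^τ δ̄^τ` to be pairwise distinct on `D_v` (the pairs `(χ̄_b, χ̄_a)`, `(χ̄_b^τ, χ̄_a^τ)`
being distinct by `p`-distinguishedness at `v` and `τ̄ v`; the four `δ`-dependent pairs are listed,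
through the entries of the integral model `ρ₀` at `g` and at `θ_τ g`, `g ∈ D_v`).  If `v` is NOT
split: `ρ` is crystalline-oriented at `v` and `δ` is unramified at `v` (then every diagonal character
extends to `Γ_{ℚ_p}` and the induction from `F_v` is ordinary and distinguished for free).
[cite: BoxerEtAl2021, §7.5.4 (arXiv:1812.09269v2 Lemma 313)] -/
def TwistLocalAt [IsGalois ℚ F] {O : ValuationSubring (PadicAlgCl p)}
    (ρ : FramedGaloisRep F (PadicAlgCl p) 2) (ρ₀ : absoluteGaloisGroup F →* GL (Fin 2) O)
    (δ : absoluteGaloisGroup F →ₜ* (PadicAlgCl p)ˣ) (τ : absoluteGaloisGroup ℚ)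
    (v : HeightOneSpectrum (𝓞 F)) : Prop :=
  (absGaloisQuot ℚ F τ • v ≠ v →
    let c : Fin 2 → absoluteGaloisGroup F → PadicAlgCl p := fun i g =>
      ((ρ₀ g).val i i : PadicAlgCl p) * ((δ g : (PadicAlgCl p)ˣ) : PadicAlgCl p)
    let θ : absoluteGaloisGroup F → absoluteGaloisGroup F := fun g => absGaloisOuterConj ℚ F τ g
    let r := fun σ : absoluteGaloisGroup (v.adicCompletion F) => absGaloisRestrict F (v.adicCompletion F) σ
    (∃ σ, Valued.v (c 1 (r σ) - c 1 (θ (r σ))) = 1) ∧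
    (∃ σ, Valued.v (c 0 (r σ) - c 0 (θ (r σ))) = 1) ∧
    (∃ σ, Valued.v (c 1 (r σ) - c 0 (θ (r σ))) = 1) ∧
    (∃ σ, Valued.v (c 1 (θ (r σ)) - c 0 (r σ)) = 1)) ∧
  (absGaloisQuot ℚ F τ • v = v →
    CrystallineOrientedAt p ρ v ∧
      ∀ 𝔓 ∈ v.primesAbove, ∀ σ ∈ 𝔓.inertia (absoluteGaloisGroup F), δ σ = 1)

/-- A TWIST DATUM `(δ, τ)` for `(ρ, ρ₀)`: `τ ∈ Γ_ℚ ∖ Γ_F`; `δ : Γ_F → ℚ̄_pˣ` continuous of finite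
order; `det ρ · δ²` is `τ`-INVARIANT (so that `Ind_F^ℚ(ρ ⊗ δ)` is symplectic — the obstruction to
the existence of such a `δ` is the class of the finite part of `det ρ` in `Ĉ_F/(2Ĉ_F + N^*Ĉ_ℚ)`,
non-zero classes exist e.g. over `ℚ(√−7)`); and the local condition `TwistLocalAt` at every
`v ∣ p`. [cite: BoxerEtAl2021, §7.5.4] -/
def TwistDatum [IsGalois ℚ F] {O : ValuationSubring (PadicAlgCl p)}
    (ρ : FramedGaloisRep F (PadicAlgCl p) 2) (ρ₀ : absoluteGaloisGroup F →* GL (Fin 2) O)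
    (δ : absoluteGaloisGroup F →ₜ* (PadicAlgCl p)ˣ) (τ : absoluteGaloisGroup ℚ) : Prop :=
  absGaloisQuot ℚ F τ ≠ 1 ∧
  (∃ m : ℕ, 0 < m ∧ ∀ g, δ g ^ m = 1) ∧
  (∀ g : absoluteGaloisGroup F,
      Matrix.GeneralLinearGroup.det (ρ (absGaloisOuterConj ℚ F τ g)) *
          δ (absGaloisOuterConj ℚ F τ g) ^ 2 =
        Matrix.GeneralLinearGroup.det (ρ g) * δ g ^ 2) ∧
  ∀ v : HeightOneSpectrum (𝓞 F), (p : 𝓞 F) ∈ v.asIdeal → TwistLocalAt p ρ ρ₀ δ τ v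

/-- A GOOD DIHEDRAL TWIST DATUM: a twist datum such that moreover `ρ ⊗ δ` is NOT `τ`-invariant
(trace form; so `Ind_F^ℚ(ρ ⊗ δ)` is irreducible, Mackey — BCGP's `δ_{M/F}` factor) and which is
GENERIC at the places `v ∤ p` where `δ` ramifies while `ρ` does not: the residual diagonal
characters of `ρ₀` at an arithmetic Frobenius there have ratio `≢ 1` (Čebotarev-choosable, since
`χ̄_a ≠ χ̄_b`; keeps the level enlargement harmless for the residual numerics).
[cite: BoxerEtAl2021, §7.5.4 (arXiv:1812.09269v2 Lemmas 312–313)] -/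
def GoodDihedralTwist [IsGalois ℚ F] {O : ValuationSubring (PadicAlgCl p)}
    (ρ : FramedGaloisRep F (PadicAlgCl p) 2) (ρ₀ : absoluteGaloisGroup F →* GL (Fin 2) O)
    (δ : absoluteGaloisGroup F →ₜ* (PadicAlgCl p)ˣ) (τ : absoluteGaloisGroup ℚ) : Prop :=
  TwistDatum p ρ ρ₀ δ τ ∧
  (∃ g : absoluteGaloisGroup F,
      ((δ g : (PadicAlgCl p)ˣ) : PadicAlgCl p) * (ρ g).val.trace ≠
        ((δ (absGaloisOuterConj ℚ F τ g) : (PadicAlgCl p)ˣ) : PadicAlgCl p) *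
          (ρ (absGaloisOuterConj ℚ F τ g)).val.trace) ∧
  (∀ v : HeightOneSpectrum (𝓞 F), (p : 𝓞 F) ∉ v.asIdeal → ρ.IsUnramifiedAt v →
      (¬ ∀ 𝔓 ∈ v.primesAbove, ∀ σ ∈ 𝔓.inertia (absoluteGaloisGroup F), δ σ = 1) →
      ∀ 𝔓 ∈ v.primesAbove, ∀ σ : absoluteGaloisGroup F, IsArithFrobAt (𝓞 F) σ 𝔓 →
        ((ρ₀ σ).val 0 0 - (ρ₀ σ).val 1 1 : O) ∉ IsLocalRing.maximalIdeal O)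

/-- The GSp₄-side LOCAL CLAUSE AT `p` for a framed `R : Γ_ℚ → GL₄(ℚ̄_p)` ("Borel-ordinary of WALL
shape `(k−1, k−1, 0, 0)` up to finite inertial order `m`, residually `p`-DISTINGUISHED"): in some
frame `Q`, `Q⁻¹ R|_{Γ_{ℚ_p}} Q` is upper triangular; on inertia the first two diagonal characters
satisfy `θ^m = ε^{(k-1)m}`, the last two `θ^m = 1`; and the four diagonal characters are pairwise
residually distinct (their differences take a value of norm one). This is the shape of
`Ind_F^ℚ(ρ ⊗ δ)|_{Γ_{ℚ_p}} = (ρ ⊗ δ)|_{D_v} ⊕ (ρ ⊗ δ)^τ|_{D_v}` for a good dihedral twist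
(BCGP §7.5.4, arXiv Lemma 313: "automatically weight 2 ordinary and p-distinguished"). [cite: BoxerEtAl2021, §7.5.4 (arXiv:1812.09269v2 Lemma 313)] -/
def WallOrdLoc (R : FramedGaloisRep ℚ (PadicAlgCl p) 4) (k m : ℕ) : Prop :=
  ∀ v : HeightOneSpectrum (𝓞 ℚ), (p : 𝓞 ℚ) ∈ v.asIdeal →
    ∃ Q : GL (Fin 4) (PadicAlgCl p),
      (∀ σ, ∀ i j : Fin 4, j < i → (Q⁻¹ * R.toLocal v σ * Q).val i j = 0) ∧
      (∀ σ ∈ absInertia (v.adicCompletion ℚ), ∀ i : Fin 4,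
        (Q⁻¹ * R.toLocal v σ * Q).val i i ^ m =
          if i.val < 2 then
            algebraMap (Padic p) (PadicAlgCl p)
              (((GaloisRep.cyclotomicCharacter (v.adicCompletion ℚ) p σ).val : PadicInt p) :
                Padic p) ^ ((k - 1) * m)
          else 1) ∧
      (∀ i j : Fin 4, i ≠ j →
        ∃ σ, Valued.v ((Q⁻¹ * R.toLocal v σ * Q).val i i - (Q⁻¹ * R.toLocal v σ * Q).val j j) = 1)

/-- `R : Γ_ℚ → GL₄(ℚ̄_p)` is a SYMPLECTIC INDUCTION of the twist `ρ ⊗ δ` along `(F/ℚ, τ)`: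
(i) on `Γ_F` its characteristic polynomials are those of `(ρ ⊗ δ) ⊕ (ρ ⊗ δ)^τ` (so
`R|_{Γ_F} ≅ (ρ ⊗ δ) ⊕ (ρ ⊗ δ)^τ` after semisimplification: `R ≅ Ind_F^ℚ(ρ ⊗ δ)`, Mackey);
(ii) `R` is symplectic with some multiplier function (BCGP §2: `ρᵀ J ρ = ν J`); (iii) `R` is
irreducible; (iv) `R` is unramified almost everywhere; (v) the wall local clause at `p` for some
parallel weight `k ≥ 2` and exponent `m > 0`. [cite: BoxerEtAl2021, §7.5.4] -/
def SymplecticInduction [IsGalois ℚ F] (ρ : FramedGaloisRep F (PadicAlgCl p) 2)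
    (δ : absoluteGaloisGroup F →ₜ* (PadicAlgCl p)ˣ) (τ : absoluteGaloisGroup ℚ)
    (R : FramedGaloisRep ℚ (PadicAlgCl p) 4) : Prop :=
  (∀ g : absoluteGaloisGroup F,
      (R (absGaloisRestrict ℚ F g)).val.charpoly =
        (((δ g : (PadicAlgCl p)ˣ) : PadicAlgCl p) • (ρ g).val).charpoly *
          (((δ (absGaloisOuterConj ℚ F τ g) : (PadicAlgCl p)ˣ) : PadicAlgCl p) •
              (ρ (absGaloisOuterConj ℚ F τ g)).val).charpoly) ∧
  (∃ ν : absoluteGaloisGroup ℚ → PadicAlgCl p, R.IsSymplecticWithMultiplierFun ν) ∧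
  R.toGaloisRep.IsIrreducible ∧
  (∀ᶠ v in cofinite, R.IsUnramifiedAt v) ∧
  ∃ k : ℕ, 2 ≤ k ∧ ∃ m : ℕ, 0 < m ∧ WallOrdLoc p R k m

/-- `R' : Γ_ℚ → GL₄(ℚ̄_p)` is a CLASSICAL ORDINARY REGULAR SIEGEL POINT (seen on `GL₄/ℚ` through
Arthur's transfer, Gee–Taïbi 2018): there is an `L`-algebraic cuspidal automorphic representation
`Π` of `GL₄(𝔸_ℚ)` Satake–Frobenius compatible with `R'` at almost every place (summit clause
`SatakeFrobCompatibleAt`); `R'` is symplectic with some multiplier; and `R'` is Borel-ordinary at `p`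
of a STRICTLY DECREASING inertial shape `a₀ > a₁ > a₂ > a₃` up to finite order (regular =
cohomological weight; Urban 2005 / Tilouine–Urban 1999 ordinarity of the Galois representation of an
ordinary Siegel cusp form). [cite: BoxerEtAl2021, §2.7 and Thm. 2.7.2] -/
def IsClassicalOrdinarySiegelPoint (ι : PadicAlgCl p ≃+* ℂ) (R' : FramedGaloisRep ℚ (PadicAlgCl p) 4) :
    Prop :=
  (∃ (hcpt : isCompact_glFiniteIntegralLevel 4 ℚ) (Pi4 : CuspidalAutomorphicRepData 4 ℚ hcpt),
      (∃ T : InfinityType ℚ 4, Pi4.1.HasInfinityType T ∧ T.IsLAlgebraic ∧ T.IsRegular) ∧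
        ∀ᶠ v in cofinite, Summit.Langlands.SatakeFrobCompatibleAt ι Pi4.1 R' v) ∧
  (∃ ν : absoluteGaloisGroup ℚ → PadicAlgCl p, R'.IsSymplecticWithMultiplierFun ν) ∧
  ∃ (a : Fin 4 → ℕ) (m : ℕ), StrictAnti a ∧ 0 < m ∧
    ∀ v : HeightOneSpectrum (𝓞 ℚ), (p : 𝓞 ℚ) ∈ v.asIdeal →
      ∃ Q : GL (Fin 4) (PadicAlgCl p),
        (∀ σ, ∀ i j : Fin 4, j < i → (Q⁻¹ * R'.toLocal v σ * Q).val i j = 0) ∧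
        (∀ σ ∈ absInertia (v.adicCompletion ℚ), ∀ i : Fin 4,
          (Q⁻¹ * R'.toLocal v σ * Q).val i i ^ m =
            algebraMap (Padic p) (PadicAlgCl p)
              (((GaloisRep.cyclotomicCharacter (v.adicCompletion ℚ) p σ).val : PadicInt p) :
                Padic p) ^ (a i * m))

/-- A SIEGEL SEED for `R` (Skinner–Wiles step (II) "there is a nice prime for some `c₀`",
transported to `GSp₄/ℚ`): an IRREDUCIBLE classical ordinary regular Siegel point `R_seed` whose
characteristic polynomials are congruent to those of `R` modulo the maximal ideal (same residual
pseudo-character; by Ribet's lemma some lattice of `R_seed` then realises a non-split residual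
extension of the Siegel-dihedral type, which SW Prop. 4.2 transports). Sources for the intended
proof: the route's seed item `EisensteinProModularSeed` (Eisenstein congruence), Ramakrishnan's
`GL₂ × GL₂ → GL₄` (the level-raised newform tensor the weight-one dihedral form of `Ind δ`), or
Yoshida congruences (Böcherer–Dummigan–Schulze-Pillot, Agarwal–Klosin). [cite: SkinnerWiles1999, §4.5] -/
def HasSiegelSeed (ι : PadicAlgCl p ≃+* ℂ) (R : FramedGaloisRep ℚ (PadicAlgCl p) 4) : Prop :=
  ∃ Rseed : FramedGaloisRep ℚ (PadicAlgCl p) 4,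
    IsClassicalOrdinarySiegelPoint p ι Rseed ∧ Rseed.toGaloisRep.IsIrreducible ∧
      ∀ (g : absoluteGaloisGroup ℚ) (i : ℕ),
        Valued.v ((R g).val.charpoly.coeff i - (Rseed g).val.charpoly.coeff i) < 1

/-- `R` is SIEGEL-PRO-AUTOMORPHIC with bad set `S` and depth `I` (the GSp₄/ℚ analogue of the crux's
conclusion `∃ 𝒰, 𝒰.IsPadicallyAutomorphic ρ`, rendered Galois-theoretically so that no Hecke
algebra of the Siegel threefold has to be constructed): `S` is a finite set of places containing
those above `p`; `I v` (for `v ∈ S`, `v ∤ p`) is an OPEN subgroup of the local inertia group — the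
fixed tame depth; and for every `N` there is a classical ordinary regular Siegel point `R'`,
unramified outside `S`, unipotent on `I v` at the places `v ∈ S`, `v ∤ p`, whose characteristic
polynomials are congruent to those of `R` modulo `p^N` at every `g ∈ Γ_ℚ`. (A `ℚ̄_p`-point of the
Hida–Tilouine–Urban–Pilloni ordinary cuspidal Hecke algebra of tame level `K^p` IS such a limit —
finiteness over `Λ` and Zariski density of the regular classical weights; conversely bounded depth
puts the limit back at finite tame level.) [cite: SkinnerWiles1999, §4.1] -/
def IsSiegelProAutomorphic (ι : PadicAlgCl p ≃+* ℂ) (S : Set (HeightOneSpectrum (𝓞 ℚ)))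
    (I : ∀ v : HeightOneSpectrum (𝓞 ℚ), Subgroup (absoluteGaloisGroup (v.adicCompletion ℚ)))
    (R : FramedGaloisRep ℚ (PadicAlgCl p) 4) : Prop :=
  S.Finite ∧ (∀ v : HeightOneSpectrum (𝓞 ℚ), (p : 𝓞 ℚ) ∈ v.asIdeal → v ∈ S) ∧
  (∀ v ∈ S, IsOpen (I v : Set (absoluteGaloisGroup (v.adicCompletion ℚ))) ∧
      I v ≤ absInertia (v.adicCompletion ℚ)) ∧
  ∀ N : ℕ, ∃ R' : FramedGaloisRep ℚ (PadicAlgCl p) 4,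
    IsClassicalOrdinarySiegelPoint p ι R' ∧
    (∀ v ∉ S, R'.IsUnramifiedAt v) ∧
    (∀ v ∈ S, (p : 𝓞 ℚ) ∉ v.asIdeal → ∀ σ ∈ I v, ((R'.toLocal v σ).val - 1) ^ 4 = 0) ∧
    ∀ (g : absoluteGaloisGroup ℚ) (i : ℕ),
      Valued.v ((R g).val.charpoly.coeff i - (R' g).val.charpoly.coeff i) ≤
        Valued.v (p : PadicAlgCl p) ^ N

/-- `R` is CLASSICALLY AUTOMORPHIC ON `GL₄/ℚ` OF WALL TYPE (the automorphy clause of the summit for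
`n = 4`, `K = ℚ`, almost-everywhere form): a cuspidal `Π` on `GL₄(𝔸_ℚ)`, `L`-algebraic with DOUBLED
infinity type `{a₀, a₀, a₁, a₁}`, `a₀ ≠ a₁` (the transfer of a limit-of-discrete-series Siegel form
of weight `(k,2)`; this pins the infinity type of the descended `π` over `F` as regular), with
Satake–Frobenius compatibility at almost all places. [folklore] -/
def IsGL4CuspidalAutomorphicAE (ι : PadicAlgCl p ≃+* ℂ) (R : FramedGaloisRep ℚ (PadicAlgCl p) 4) :
    Prop :=
  ∃ (hcpt : isCompact_glFiniteIntegralLevel 4 ℚ) (Pi4 : CuspidalAutomorphicRepData 4 ℚ hcpt),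
    (∃ T : InfinityType ℚ 4, Pi4.1.HasInfinityType T ∧ T.IsLAlgebraic ∧
      ∀ σ : ℚ →+* ℂ, ∃ a₀ a₁ : ℂ, a₀ ≠ a₁ ∧ (T σ).map ArchWeight.a = {a₀, a₀, a₁, a₁}) ∧
    ∀ᶠ v in cofinite, Summit.Langlands.SatakeFrobCompatibleAt ι Pi4.1 R v

/-- `ρ : Γ_F → GL₂(ℚ̄_p)` is CLASSICALLY MODULAR OVER `F` BY A REGULAR `π` (the conclusion of the
route's target `ReducibleOrdinaryModular` for a GIVEN compactness witness, with the infinity type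
recorded as `L`-algebraic AND regular — i.e. `π` is cohomological up to the half twist, as a
parallel-weight-`k ≥ 2` Bianchi eigenform is): Satake–Frobenius compatibility at almost all places.
[folklore] -/
def IsBianchiModularAE (hcpt : isCompact_glFiniteIntegralLevel 2 F) (ι : PadicAlgCl p ≃+* ℂ)
    (ρ : FramedGaloisRep F (PadicAlgCl p) 2) : Prop :=
  ∃ π : CuspidalAutomorphicRepData 2 F hcpt,
    (∃ T : InfinityType F 2, π.1.HasInfinityType T ∧ T.IsLAlgebraic ∧ T.IsRegular) ∧
      ∀ᶠ v in cofinite, Summit.Langlands.SatakeFrobCompatibleAt ι π.1 ρ v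

/-- THE REGIME of the line: the Skinner–Wiles residual numerics in the tree's form
`UniqueAdmissibleExtension ρ ρ₀` (Literature `AdmissibleExtensionRegime`: the finite-order stratum
of the reducible locus of every universal nearly ordinary deformation ring modelling `(ρ, ρ₀)` at
the base level has dimension `≤ 2` — uniqueness of the admissible residual extension,
Berger–Klosin's situation; holds for the route's witness and 20 of the 21 fields tested, kit
j007870/j008702), AND the existence of a twist datum (symplectifiable determinant + the local
condition at `p`). [cite: SkinnerWiles1999, Lemma 2.7] -/
def Regime [IsGalois ℚ F] {O : ValuationSubring (PadicAlgCl p)}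
    (ρ : FramedGaloisRep F (PadicAlgCl p) 2) (ρ₀ : absoluteGaloisGroup F →* GL (Fin 2) O) : Prop :=
  Literature.NumberTheory.GaloisRepresentations.UniqueAdmissibleExtension ρ ρ₀ ∧
    ∃ (δ : absoluteGaloisGroup F →ₜ* (PadicAlgCl p)ˣ) (τ : absoluteGaloisGroup ℚ), TwistDatum p ρ ρ₀ δ τ

end Vocabulary

/-! ## 1b. The statements of the stubs as NAMED `Prop`s (`S.*`): the hypotheses of
`ReducibleOrdinaryProModular_of` are these BY NAME (the skeleton check refuses inline `∀`-hypotheses);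
the registered stubs of §2 restate them verbatim (definitionally equal). -/

/-- Statement of `stub_dihedralSymplecticInduction`. -/
def S.stub_dihedralSymplecticInduction : Prop :=
    ∀ (F : Type) [Field F] [NumberField F] [IsGalois ℚ F], IsTotallyComplex F → Module.finrank ℚ F = 2 →
    ∀ (p : ℕ) [Fact p.Prime], p ≠ 2 →
    ∀ (O : ValuationSubring (PadicAlgCl p)),
      O = (Valued.v : Valuation (PadicAlgCl p) NNReal).valuationSubring →
    ∀ (ρ : FramedGaloisRep F (PadicAlgCl p) 2) (ρ₀ : absoluteGaloisGroup F →* GL (Fin 2) O)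
      (δ₀ : absoluteGaloisGroup F →ₜ* (PadicAlgCl p)ˣ) (τ : absoluteGaloisGroup ℚ),
      CruxHyp p O ρ ρ₀ → TwistDatum p ρ ρ₀ δ₀ τ →
      ∃ (δ : absoluteGaloisGroup F →ₜ* (PadicAlgCl p)ˣ) (R : FramedGaloisRep ℚ (PadicAlgCl p) 4),
        GoodDihedralTwist p ρ ρ₀ δ τ ∧ SymplecticInduction p ρ δ τ R

/-- Statement of `stub_siegelSeed`. -/
def S.stub_siegelSeed : Prop :=
    ∀ (F : Type) [Field F] [NumberField F] [IsGalois ℚ F], IsTotallyComplex F → Module.finrank ℚ F = 2 →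
    ∀ (p : ℕ) [Fact p.Prime], p ≠ 2 →
    ∀ (O : ValuationSubring (PadicAlgCl p)),
      O = (Valued.v : Valuation (PadicAlgCl p) NNReal).valuationSubring →
    ∀ (ι : PadicAlgCl p ≃+* ℂ)
      (ρ : FramedGaloisRep F (PadicAlgCl p) 2) (ρ₀ : absoluteGaloisGroup F →* GL (Fin 2) O)
      (δ : absoluteGaloisGroup F →ₜ* (PadicAlgCl p)ˣ) (τ : absoluteGaloisGroup ℚ)
      (R : FramedGaloisRep ℚ (PadicAlgCl p) 4),
      CruxHyp p O ρ ρ₀ →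
      GoodDihedralTwist p ρ ρ₀ δ τ → SymplecticInduction p ρ δ τ R →
      HasSiegelSeed p ι R

/-- Statement of `stub_siegelSkinnerWiles`. -/
def S.stub_siegelSkinnerWiles : Prop :=
    ∀ (F : Type) [Field F] [NumberField F] [IsGalois ℚ F], IsTotallyComplex F → Module.finrank ℚ F = 2 →
    ∀ (p : ℕ) [Fact p.Prime], p ≠ 2 →
    ∀ (O : ValuationSubring (PadicAlgCl p)),
      O = (Valued.v : Valuation (PadicAlgCl p) NNReal).valuationSubring →
    ∀ (ι : PadicAlgCl p ≃+* ℂ)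
      (ρ : FramedGaloisRep F (PadicAlgCl p) 2) (ρ₀ : absoluteGaloisGroup F →* GL (Fin 2) O)
      (δ : absoluteGaloisGroup F →ₜ* (PadicAlgCl p)ˣ) (τ : absoluteGaloisGroup ℚ)
      (R : FramedGaloisRep ℚ (PadicAlgCl p) 4),
      CruxHyp p O ρ ρ₀ → Regime p ρ ρ₀ →
      GoodDihedralTwist p ρ ρ₀ δ τ → SymplecticInduction p ρ δ τ R → HasSiegelSeed p ι R →
      ∃ (S : Set (HeightOneSpectrum (𝓞 ℚ)))
        (I : ∀ v : HeightOneSpectrum (𝓞 ℚ), Subgroup (absoluteGaloisGroup (v.adicCompletion ℚ))),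
        IsSiegelProAutomorphic p ι S I R

/-- Statement of `stub_wallClassicality`. -/
def S.stub_wallClassicality : Prop :=
    ∀ (F : Type) [Field F] [NumberField F] [IsGalois ℚ F], IsTotallyComplex F → Module.finrank ℚ F = 2 →
    ∀ (p : ℕ) [Fact p.Prime], p ≠ 2 →
    ∀ (O : ValuationSubring (PadicAlgCl p)),
      O = (Valued.v : Valuation (PadicAlgCl p) NNReal).valuationSubring →
    ∀ (ι : PadicAlgCl p ≃+* ℂ)
      (ρ : FramedGaloisRep F (PadicAlgCl p) 2) (ρ₀ : absoluteGaloisGroup F →* GL (Fin 2) O)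
      (δ : absoluteGaloisGroup F →ₜ* (PadicAlgCl p)ˣ) (τ : absoluteGaloisGroup ℚ)
      (R : FramedGaloisRep ℚ (PadicAlgCl p) 4)
      (S : Set (HeightOneSpectrum (𝓞 ℚ)))
      (I : ∀ v : HeightOneSpectrum (𝓞 ℚ), Subgroup (absoluteGaloisGroup (v.adicCompletion ℚ))),
      CruxHyp p O ρ ρ₀ → GoodDihedralTwist p ρ ρ₀ δ τ → SymplecticInduction p ρ δ τ R →
      IsSiegelProAutomorphic p ι S I R →
      IsGL4CuspidalAutomorphicAE p ι R

/-- Statement of `stub_deinduction`. -/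
def S.stub_deinduction : Prop :=
    ∀ (F : Type) [Field F] [NumberField F] [IsGalois ℚ F], IsTotallyComplex F → Module.finrank ℚ F = 2 →
    ∀ (p : ℕ) [Fact p.Prime], p ≠ 2 →
    ∀ (O : ValuationSubring (PadicAlgCl p)),
      O = (Valued.v : Valuation (PadicAlgCl p) NNReal).valuationSubring →
    ∀ (hcpt : isCompact_glFiniteIntegralLevel 2 F) (ι : PadicAlgCl p ≃+* ℂ)
      (ρ : FramedGaloisRep F (PadicAlgCl p) 2) (ρ₀ : absoluteGaloisGroup F →* GL (Fin 2) O)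
      (δ : absoluteGaloisGroup F →ₜ* (PadicAlgCl p)ˣ) (τ : absoluteGaloisGroup ℚ)
      (R : FramedGaloisRep ℚ (PadicAlgCl p) 4),
      CruxHyp p O ρ ρ₀ → GoodDihedralTwist p ρ ρ₀ δ τ → SymplecticInduction p ρ δ τ R →
      IsGL4CuspidalAutomorphicAE p ι R →
      IsBianchiModularAE p hcpt ι ρ

/-- Statement of `stub_proModOfClassical`. -/
def S.stub_proModOfClassical : Prop :=
    ∀ (F : Type) [Field F] [NumberField F], IsTotallyComplex F → Module.finrank ℚ F = 2 →
    ∀ (p : ℕ) [Fact p.Prime], p ≠ 2 →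
    ∀ (O : ValuationSubring (PadicAlgCl p)),
      O = (Valued.v : Valuation (PadicAlgCl p) NNReal).valuationSubring →
    ∀ (hcpt : isCompact_glFiniteIntegralLevel 2 F) (ι : PadicAlgCl p ≃+* ℂ)
      (ρ : FramedGaloisRep F (PadicAlgCl p) 2) (ρ₀ : absoluteGaloisGroup F →* GL (Fin 2) O),
      CruxHyp p O ρ ρ₀ → IsBianchiModularAE p hcpt ι ρ → ProMod p ρ

/-- Statement of `stub_complementRegime`. -/
def S.stub_complementRegime : Prop :=
    ∀ (F : Type) [Field F] [NumberField F] [IsGalois ℚ F], IsTotallyComplex F → Module.finrank ℚ F = 2 →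
    ∀ (p : ℕ) [Fact p.Prime], p ≠ 2 →
    ∀ (O : ValuationSubring (PadicAlgCl p)),
      O = (Valued.v : Valuation (PadicAlgCl p) NNReal).valuationSubring →
    ∀ (ρ : FramedGaloisRep F (PadicAlgCl p) 2) (ρ₀ : absoluteGaloisGroup F →* GL (Fin 2) O),
      CruxHyp p O ρ ρ₀ → ¬ Regime p ρ ρ₀ → ProMod p ρ

/-! ## 2. The registered stubs -/

/-- **S1 (M/L; class field theory + linear algebra; BCGP §7.5.4 with `F := ℚ`, `K :=` our `F`).**
DIHEDRAL SYMPLECTIC INDUCTION: a twist datum `(δ₀, τ)` can be improved to a GOOD one `(δ, τ)`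
(same local behaviour above `p`) carrying a symplectic induction `R = Ind_F^ℚ(ρ ⊗ δ)` with the wall
local clause.  Proof sketch: multiply `δ₀` by a quadratic character `μ` of `Γ_F` trivial on the
decomposition groups above `p`, with `μ^τ/μ ≠ 1` avoiding the (at most four) classes for which
`ρ ⊗ δ₀μ ≅ (ρ ⊗ δ₀μ)^τ` (if `ρ^τ ≅ ρ ⊗ λ` for a character `λ` the condition is `μ^{τ}/μ ≠ λ·(δ₀/δ₀^τ)`;
`ρ` irreducible is fixed by at most three quadratic twists), ramified only at Čebotarev-chosen
places where `ρ` is unramified and `χ̄_a(Frob) ≠ χ̄_b(Frob)` (Grunwald–Wang); then build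
`R := Ind_F^ℚ(ρ ⊗ δ)` as a continuous homomorphism `Γ_ℚ → GL₄(ℚ̄_p)` (Mathlib induced
representation on `ℚ̄_p[Γ_ℚ] ⊗_{ℚ̄_p[Γ_F]} -`, a frame, continuity from that of `ρ` and openness of
`Γ_F`), check the characteristic polynomials on `Γ_F` (Mackey), the induced alternating form with
multiplier extending `det ρ · δ²` (BCGP §7.5.4 "symplectic induction"), irreducibility (Mackey:
`ρ ⊗ δ ≇ (ρ ⊗ δ)^τ`), almost-everywhere unramifiedness, and the wall local clause at `p` from
`OrdLoc` at `v` and `τ̄ v` (split case: block sum of the two oriented frames; non-split case: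
induction from `F_v` of characters that extend). [cite: BoxerEtAl2021, §7.5.4 (arXiv:1812.09269v2 Lemma 313)] -/
theorem stub_dihedralSymplecticInduction :
    ∀ (F : Type) [Field F] [NumberField F] [IsGalois ℚ F], IsTotallyComplex F → Module.finrank ℚ F = 2 →
    ∀ (p : ℕ) [Fact p.Prime], p ≠ 2 →
    ∀ (O : ValuationSubring (PadicAlgCl p)),
      O = (Valued.v : Valuation (PadicAlgCl p) NNReal).valuationSubring →
    ∀ (ρ : FramedGaloisRep F (PadicAlgCl p) 2) (ρ₀ : absoluteGaloisGroup F →* GL (Fin 2) O)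
      (δ₀ : absoluteGaloisGroup F →ₜ* (PadicAlgCl p)ˣ) (τ : absoluteGaloisGroup ℚ),
      CruxHyp p O ρ ρ₀ → TwistDatum p ρ ρ₀ δ₀ τ →
      ∃ (δ : absoluteGaloisGroup F →ₜ* (PadicAlgCl p)ˣ) (R : FramedGaloisRep ℚ (PadicAlgCl p) 4),
        GoodDihedralTwist p ρ ρ₀ δ τ ∧ SymplecticInduction p ρ δ τ R := by
  sorry

/-- **S2 (L; Skinner–Wiles step (II) transported to the Siegel threefold).** SIEGEL SEED: for a
symplectic induction `R` of `ρ ⊗ δ` as in S1 there is an irreducible classical ordinary regular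
Siegel point with the residual pseudo-character of `R`.  Intended proof: the Eisenstein congruence
of the route's seed item (a level-raised Eisenstein-congruent ordinary newform `f` over `ℚ` on the
Billerey–Menares range, or Berger's Bianchi Eisenstein congruence + theta lift), tensored with the
weight-one dihedral form of `Ind_F^ℚ δ` by Ramakrishnan's `GL₂ × GL₂ → GL₄` (cuspidal, symplectic,
ordinary of regular weight after moving `f` in its Hida family off the wall), or a Yoshida
congruence (Böcherer–Dummigan–Schulze-Pillot 2012; Agarwal–Klosin 2013). Residual congruence of
characteristic polynomials is all that is asked (SW Prop. 4.2 transports extension classes).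
[cite: SkinnerWiles1999, §4.5] -/
theorem stub_siegelSeed :
    ∀ (F : Type) [Field F] [NumberField F] [IsGalois ℚ F], IsTotallyComplex F → Module.finrank ℚ F = 2 →
    ∀ (p : ℕ) [Fact p.Prime], p ≠ 2 →
    ∀ (O : ValuationSubring (PadicAlgCl p)),
      O = (Valued.v : Valuation (PadicAlgCl p) NNReal).valuationSubring →
    ∀ (ι : PadicAlgCl p ≃+* ℂ)
      (ρ : FramedGaloisRep F (PadicAlgCl p) 2) (ρ₀ : absoluteGaloisGroup F →* GL (Fin 2) O)
      (δ : absoluteGaloisGroup F →ₜ* (PadicAlgCl p)ˣ) (τ : absoluteGaloisGroup ℚ)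
      (R : FramedGaloisRep ℚ (PadicAlgCl p) 4),
      CruxHyp p O ρ ρ₀ →
      GoodDihedralTwist p ρ ρ₀ δ τ → SymplecticInduction p ρ δ τ R →
      HasSiegelSeed p ι R := by
  sorry

/-- **S3 — THE HEART (XL; Skinner–Wiles 1999 §§2–4 for `GSp₄/ℚ` in the ordinary Siegel Hida
family, Taylor–Wiles defect ZERO).** SIEGEL SKINNER–WILES: in the regime, a symplectic induction
`R = Ind_F^ℚ(ρ ⊗ δ)` with a Siegel seed is Siegel-pro-automorphic (a `ℚ̄_p`-point of the ordinary
cuspidal Hecke algebra of the Siegel threefold at some tame level, rendered as a bounded-depth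
`p`-adic limit of classical ordinary regular Siegel points).  Proof template, step by step on SW99:
(I) `R_𝒟` = universal Borel-ordinary symplectic deformation ring of the non-split residual datum
`R̄ = Ind(ρ̄_c ⊗ δ̄)` with its ordinary flag (representable: `p`-distinguished by S1; Tilouine's
`GSp₄` deformation theory), a finite? `Λ₃ = 𝒪⟦T₁,T₂,T₃⟧`-algebra whose irreducible components have
Krull dimension `≥ 4 = 1 + dim Λ₃ − l₀`, `l₀ = 0` (Böckle presentation; the `h⁰(ad^*(1))` term
vanishes at a level containing a ramified place of `δ`, Greenberg–Wiles); the REDUCIBLE locus is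
Siegel-parabolic with Levi datum a deformation of the dihedral `Ind(χ̄_a δ̄)`: by Shapiro its
`Λ`-adic strata are the SYMPLECTIFIABLE strata of SW Lemma 2.7 over `F`, of dimension
`1 + (dim Z + r_Z − 1) ≤ 3` from TORSION-NESS of the `p`-split Iwasawa module alone (weak Leopoldt /
Rubin; no `μ = 0`, no coprimality of Katz `p`-adic `L`-functions), the residual pencil has
dimension `r₀ + 1 ≤ 3` by `UniqueAdmissibleExtension` (the `μ̄`-summands `H¹(ℚ, μ̄), H¹(ℚ, μ̄η)` of
`Sym²(Ind χ̄_aδ̄) ⊗ ν̄⁻¹` are killed by the choice of `δ` in S1); so every component has good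
dimension-one primes `𝔭` (char. `p`, `R_𝔭` irreducible of infinite-order ratios). (Hecke side) the
ordinary cuspidal Hecke algebra `𝕋^ord(K^p)` of `GSp₄/ℚ` (Tilouine–Urban 1999; Hida 2002; Pilloni
2012: finite over `Λ`, control at regular weights `k₁ ≥ k₂ ≥ 4`, `Λ`-free module of ordinary
`Λ`-adic cusp forms) carries a 4-dimensional Galois pseudo-representation with ordinary local–global
compatibility at `p` (Urban 2005) and at `ℓ ≠ p` (Weissauer/Sorensen/Mok) by DENSITY OF CLASSICAL
REGULAR POINTS — no torsion local–global compatibility is needed anywhere. (P1) `R_𝔭^{red} = 𝕋_𝔭` at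
a nice prime by SW §3 patching of the `Λ[Δ_Q]`-free modules of ordinary `Λ`-adic Siegel cusp forms
at Taylor–Wiles levels (BCGP §7.6 Taylor–Wiles primes for `GSp₄`, chosen relative to the big-image
`R_𝔭` over `k⟦T⟧`; BCGP §4/§7 freeness at level `K₁(q)`; `l₀ = 0`, ONE cohomological degree).
(III)–(IV) SW §§4.2–4.4: Raynaud/Grothendieck connectedness (LANDED in the tree:
`GrothendieckConnectedness_holds`, `stub_raynaudConnectedness` p122088) + transport of extension
classes (SW Prop. 4.2) from the seed's component to the component of `R`; every prime of it, in
particular `R`, is pro-automorphic. Honest open sub-bets: (B) margin-one crossings are big (as in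
fine-selmer), and the non-CM components of the Levi family have generic Selmer rank `≤ 1` on
divisors. [cite: SkinnerWiles1999, §§2.2–2.3, 3, 4.1–4.4] -/
theorem stub_siegelSkinnerWiles :
    ∀ (F : Type) [Field F] [NumberField F] [IsGalois ℚ F], IsTotallyComplex F → Module.finrank ℚ F = 2 →
    ∀ (p : ℕ) [Fact p.Prime], p ≠ 2 →
    ∀ (O : ValuationSubring (PadicAlgCl p)),
      O = (Valued.v : Valuation (PadicAlgCl p) NNReal).valuationSubring →
    ∀ (ι : PadicAlgCl p ≃+* ℂ)
      (ρ : FramedGaloisRep F (PadicAlgCl p) 2) (ρ₀ : absoluteGaloisGroup F →* GL (Fin 2) O)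
      (δ : absoluteGaloisGroup F →ₜ* (PadicAlgCl p)ˣ) (τ : absoluteGaloisGroup ℚ)
      (R : FramedGaloisRep ℚ (PadicAlgCl p) 4),
      CruxHyp p O ρ ρ₀ → Regime p ρ ρ₀ →
      GoodDihedralTwist p ρ ρ₀ δ τ → SymplecticInduction p ρ δ τ R → HasSiegelSeed p ι R →
      ∃ (S : Set (HeightOneSpectrum (𝓞 ℚ)))
        (I : ∀ v : HeightOneSpectrum (𝓞 ℚ), Subgroup (absoluteGaloisGroup (v.adicCompletion ℚ))),
        IsSiegelProAutomorphic p ι S I R := by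
  sorry

/-- **S4 — THE EXIT ON THE WALL (XL, open in print: Pilloni, Duke 169 (2020) p. 1650; BCGP §1.2).**
WALL CLASSICALITY FOR INDUCED POINTS: a Siegel-pro-automorphic symplectic induction `R` (hence de
Rham of Hodge–Tate shape `(k−1,k−1,0,0)` and Borel-ordinary in the two `τ`-swapped ways —
"doubly ordinary", the Buzzard–Taylor shape one dimension up) is classically automorphic on
`GL₄/ℚ`.  Intended proof: `R` is a `ℚ̄_p`-point over the wall weight `(k,2)` of the Hida–Pilloni
2-variable ordinary family `M′` (finite free over `Λ₂`, Pilloni 2020 p. 1650); ordinary ⇒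
overconvergent in families (Andreatta–Iovita–Pilloni eigenvariety); analytic continuation to the
`p`-rank-`≥ 1` locus using the second ordinary refinement (Pilloni, Duke 157 (2011); Buzzard–Taylor
1999; BCGP §§8–9 étale descent given multiplicity one); then Pilloni 2020 Thm. 1.1 (1) (`M ⊗ k =`
classical `U`-ordinary `RΓ(X_{Kli(p)}, Ω^{(k,2)}(−D))` for all `k ≥ 0`) and §14 (small slope is
classical); the classical limit-of-discrete-series `Π` on `GSp₄` transfers to a cuspidal `Π₄` on
`GL₄` (Arthur; Gee–Taïbi 2018), cuspidal because `R` is irreducible, with Galois representation `R`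
(Taylor 1991, Weissauer, Mok 2014). [cite: BoxerEtAl2021, §1.2] -/
theorem stub_wallClassicality :
    ∀ (F : Type) [Field F] [NumberField F] [IsGalois ℚ F], IsTotallyComplex F → Module.finrank ℚ F = 2 →
    ∀ (p : ℕ) [Fact p.Prime], p ≠ 2 →
    ∀ (O : ValuationSubring (PadicAlgCl p)),
      O = (Valued.v : Valuation (PadicAlgCl p) NNReal).valuationSubring →
    ∀ (ι : PadicAlgCl p ≃+* ℂ)
      (ρ : FramedGaloisRep F (PadicAlgCl p) 2) (ρ₀ : absoluteGaloisGroup F →* GL (Fin 2) O)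
      (δ : absoluteGaloisGroup F →ₜ* (PadicAlgCl p)ˣ) (τ : absoluteGaloisGroup ℚ)
      (R : FramedGaloisRep ℚ (PadicAlgCl p) 4)
      (S : Set (HeightOneSpectrum (𝓞 ℚ)))
      (I : ∀ v : HeightOneSpectrum (𝓞 ℚ), Subgroup (absoluteGaloisGroup (v.adicCompletion ℚ))),
      CruxHyp p O ρ ρ₀ → GoodDihedralTwist p ρ ρ₀ δ τ → SymplecticInduction p ρ δ τ R →
      IsSiegelProAutomorphic p ι S I R →
      IsGL4CuspidalAutomorphicAE p ι R := by
  sorry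

/-- **S5 (M/L; Arthur–Clozel 1989 Ch. 3 Thm. 4.2 (b) + Thm. 3.1, tree facts
`ArthurClozel1989_inducedLift_of_twist_eq`, `ArthurClozel1989_fibres_of_baseChange`; Jacquet–Shalika;
twisting by `δ⁻¹`, tree `CuspidalAutomorphicRepData.twist`).** DE-INDUCTION: if `R = Ind_F^ℚ(ρ ⊗ δ)`
is cuspidal automorphic on `GL₄/ℚ` then `ρ` is classically modular over `F`: `Π ≅ Π ⊗ η_{F/ℚ}`
(Satake parameters at inert primes), so `Π` is automorphically induced from a cuspidal `π₁` on
`GL₂(𝔸_F)` (Thm. 4.2 (b)); comparing Frobenius polynomials on `Γ_F` (Chebotarev, Brauer–Nesbitt: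
tree `nonempty_equiv_of_hasFrobCharpolyAt_eventually`), `ρ_{π₁} ∈ {ρ ⊗ δ, (ρ ⊗ δ)^τ}`; then
`π := π₁ ⊗ δ⁻¹` or its `τ`-conjugate matches `ρ`; `L`-algebraicity from that of `Π`.
[cite: ArthurClozelAMS120, Ch. 3 Thm. 4.2 (b)] -/
theorem stub_deinduction :
    ∀ (F : Type) [Field F] [NumberField F] [IsGalois ℚ F], IsTotallyComplex F → Module.finrank ℚ F = 2 →
    ∀ (p : ℕ) [Fact p.Prime], p ≠ 2 →
    ∀ (O : ValuationSubring (PadicAlgCl p)),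
      O = (Valued.v : Valuation (PadicAlgCl p) NNReal).valuationSubring →
    ∀ (hcpt : isCompact_glFiniteIntegralLevel 2 F) (ι : PadicAlgCl p ≃+* ℂ)
      (ρ : FramedGaloisRep F (PadicAlgCl p) 2) (ρ₀ : absoluteGaloisGroup F →* GL (Fin 2) O)
      (δ : absoluteGaloisGroup F →ₜ* (PadicAlgCl p)ˣ) (τ : absoluteGaloisGroup ℚ)
      (R : FramedGaloisRep ℚ (PadicAlgCl p) 4),
      CruxHyp p O ρ ρ₀ → GoodDihedralTwist p ρ ρ₀ δ τ → SymplecticInduction p ρ δ τ R →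
      IsGL4CuspidalAutomorphicAE p ι R →
      IsBianchiModularAE p hcpt ι ρ := by
  sorry

/-- **S6 (M; the dictionary "classical cuspidal Bianchi eigenform of cohomological parallel weight
⇒ `p`-adically automorphic of some tame level").** A cuspidal `L`-algebraic `π` on `GL₂(𝔸_F)`
matching the irreducible, a.e. unramified, ordinary-of-parallel-weight-`k ≥ 2` representation `ρ`
at almost all places is cohomological of weight `(k,k)` (Clozel's purity / the infinity type read off
from the Hodge–Tate weights through Satake–Frobenius compatibility and `L`-algebraicity), hence
contributes a Hecke eigenclass to `H^•(X_U, V_k)` (Harder; Borel–Wallach; tree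
`hasSatakeParamAt_iff_L2_eventually`), hence — writing `V_k/p^s` through the `p`-power tower — a
continuous `ℚ̄_p`-point of the completed-cohomology Hecke algebra `𝕋(𝒰)` with `𝒰.bad ⊇`
ramification ∪ `{v ∣ p}` (Emerton 2006 §2.3; Calegari–Emerton 2011 §2). [cite: GeeNewton2020, §2.1.3] -/
theorem stub_proModOfClassical :
    ∀ (F : Type) [Field F] [NumberField F], IsTotallyComplex F → Module.finrank ℚ F = 2 →
    ∀ (p : ℕ) [Fact p.Prime], p ≠ 2 →
    ∀ (O : ValuationSubring (PadicAlgCl p)),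
      O = (Valued.v : Valuation (PadicAlgCl p) NNReal).valuationSubring →
    ∀ (hcpt : isCompact_glFiniteIntegralLevel 2 F) (ι : PadicAlgCl p ≃+* ℂ)
      (ρ : FramedGaloisRep F (PadicAlgCl p) 2) (ρ₀ : absoluteGaloisGroup F →* GL (Fin 2) O),
      CruxHyp p O ρ ρ₀ → IsBianchiModularAE p hcpt ι ρ → ProMod p ρ := by
  sorry

/-- **S7 — REGIME COMPLEMENT (the crux itself on the complement of `Regime`; honest label, no
mechanism on this line: `p` ramified in `F` (BCGP arXiv Lemma 312 is written for `p` unramified and split in the totally real base; a ramified-`p`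
version of the dihedral crossing is plausible but unwritten), `det ρ` not symplectifiable by a finite
twist (thin but non-empty: `Ĉ_F/(2Ĉ_F+N^*Ĉ_ℚ) ≠ 0`, e.g. over `ℚ(√−7)`; only `GL₄/ℚ` hosts `Ind ρ`
there), or more than one admissible residual extension (`r₀ ≥ 2`; SW's base change cure is
unavailable)).  The strategist census recommends that the tenure planner SPLIT the crux item along
`Regime` so that this stub disappears from the line.** [folklore] -/
theorem stub_complementRegime :
    ∀ (F : Type) [Field F] [NumberField F] [IsGalois ℚ F], IsTotallyComplex F → Module.finrank ℚ F = 2 →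
    ∀ (p : ℕ) [Fact p.Prime], p ≠ 2 →
    ∀ (O : ValuationSubring (PadicAlgCl p)),
      O = (Valued.v : Valuation (PadicAlgCl p) NNReal).valuationSubring →
    ∀ (ρ : FramedGaloisRep F (PadicAlgCl p) 2) (ρ₀ : absoluteGaloisGroup F →* GL (Fin 2) O),
      CruxHyp p O ρ ρ₀ → ¬ Regime p ρ ρ₀ → ProMod p ρ := by
  sorry

/-! ## 3. The kernel-checked composition -/

/-- **The line closes the crux.** S1–S7 ⟹ `ReducibleOrdinaryProModular`, BY NAME (through the
definitional `crux_iff` of the Defs file). Pure logic: fix the crux's binders; `F/ℚ` is Galois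
(quadratic, characteristic zero); choose `ι : ℚ̄_p ≃ ℂ` (tree
`nonempty_algebraicClosure_padic_ringEquiv_complex`) and a compactness witness for `GL₂/F`
(tree `isCompact_glFiniteIntegralLevel_holds`); split on `Regime`; in the regime run
S1 → S2 → S3 → S4 → S5 → S6, outside it S7. [folklore] -/
theorem ReducibleOrdinaryProModular_of (h1 : S.stub_dihedralSymplecticInduction) (h2 : S.stub_siegelSeed)
    (h3 : S.stub_siegelSkinnerWiles) (h4 : S.stub_wallClassicality) (h5 : S.stub_deinduction)
    (h6 : S.stub_proModOfClassical) (h7 : S.stub_complementRegime) :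
    ReducibleOrdinaryProModular := by
  rw [crux_iff]
  intro F _ _ hF hdeg p _ hp O hO ρ ρ₀ hirr hunr hmod hloc
  haveI : Algebra.IsQuadraticExtension ℚ F := ⟨hdeg⟩
  haveI : IsGalois ℚ F := inferInstance
  have hC : CruxHyp p O ρ ρ₀ := ⟨hirr, hunr, hmod, hloc⟩
  by_cases hreg : Regime p ρ ρ₀
  · obtain ⟨ι⟩ :=
      (Literature.NumberTheory.GaloisRepresentations.NumberField.nonempty_algebraicClosure_padic_ringEquiv_complex p :
        Nonempty (PadicAlgCl p ≃+* ℂ))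
    have hcpt : isCompact_glFiniteIntegralLevel 2 F := isCompact_glFiniteIntegralLevel_holds 2 F
    obtain ⟨δ₀, τ, hδ₀⟩ := hreg.2
    obtain ⟨δ, R, hδ, hR⟩ := h1 F hF hdeg p hp O hO ρ ρ₀ δ₀ τ hC hδ₀
    have hseed := h2 F hF hdeg p hp O hO ι ρ ρ₀ δ τ R hC hδ hR
    obtain ⟨S, I, hpro⟩ := h3 F hF hdeg p hp O hO ι ρ ρ₀ δ τ R hC hreg hδ hR hseed
    have hGL4 := h4 F hF hdeg p hp O hO ι ρ ρ₀ δ τ R S I hC hδ hR hpro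
    have hmodF := h5 F hF hdeg p hp O hO hcpt ι ρ ρ₀ δ τ R hC hδ hR hGL4
    exact h6 F hF hdeg p hp O hO hcpt ι ρ ρ₀ hC hmodF
  · exact h7 F hF hdeg p hp O hO ρ ρ₀ hC hreg

/-- **Proof of the crux from the registered stubs** (sorries exactly in `stub_*`). [folklore] -/
theorem ReducibleOrdinaryProModular_proof : ReducibleOrdinaryProModular :=
  ReducibleOrdinaryProModular_of stub_dihedralSymplecticInduction stub_siegelSeed
    stub_siegelSkinnerWiles stub_wallClassicality stub_deinduction stub_proModOfClassical
    stub_complementRegime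

end

end Summit.Langlands.Langlands.Cruxes.ReducibleOrdinaryProModular.SiegelWallSkinnerWiles
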